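import Literature.AlgebraicGeometry.Motives.GaloisThickeningSheetCover   -- ★ SHEET-COVER (A-p01 p845161) → ★ `GaloisThickeningFrobeniusSheet` (B-p18 p845097∕p845128)
import HarnessLib

/-!
# The SHEET-WISE, deck-equivariant shadow of Frobenius on the special fibre of a model of the Galois thickening
# (sequel of ★ `GaloisThickeningFrobeniusSheet`; P6a ED. 3 ∕ P6c «SHEETS-2» ∕ ref1 n25 (J4))

Topic `Literature/AlgebraicGeometry/Motives`, namespace `Literature.AlgebraicGeometry.Motives.IntegralModel`.  THEOREMS only (no def, no instance, no
notation, no named fact, no `sorry`).  Cell `hodgecm-mathlib`, P6 «MOD programme», LEAD M-12c (b) → A-p01 (g23): «FROB-SHEET ED. 3 (sheet-wise `Fr₀`,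
heads (i)(ii)(iii) UNDER `hdisj`)».  It is a SEQUEL file and not an append-only edition of ★ `GaloisThickeningFrobeniusSheet` for a kernel reason: it
needs ★ SHEET-COVER (`Motives/GaloisThickeningSheetCover`), which itself imports ★ `GaloisThickeningFrobeniusSheet` (import cycle otherwise).
HC_CM is proved only modulo the printed citations until rung 0 closes; nothing here is about HC.

THE MATHEMATICS (P6c «SHEETS-2», ref1 n25∕NM-1, A-p03 «DISJOINT SPECIAL SHEETS»).  `K` a number field, `v` a finite place, `Ω = \overline{K_v}`,
`κ̄ = κ̄(v)`, `σ ∈ Γ_{K_v}` an arithmetic Frobenius; `L ∕ K` normal with group `Γ = Aut(L ∕ K)`; `X` a `K`-scheme, `𝓨` a PROPER FLAT `𝒪_{K,(v)}`-model of the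
thickening `R_L X` with an action `θ` of `Γ × G` whose `Γ`-part has generic fibre the deck action (the binder `_hθ` of the letter MH, literally), `e : L → Ω`
a sheet.  ★ `GaloisThickeningFrobeniusSheet` gives ONE deck transformation `γ_e` (`σ ∘ e = e ∘ γ_e`) with `θ(γ_e)_s (F̃ (red (ℓ_e P))) = red (ℓ_e (σ • P))`
— the UNIFORM shadow `θ(γ_e)_s ∘ F̃`, which reads Frobenius correctly on the sheet `e` ONLY: on the sheet `e ∘ β⁻¹` the correct deck correction is the
CONJUGATE `β γ_e β⁻¹`, so a uniform shadow is right on every sheet iff `γ_e` is central (false for the non-abelian `Γ` of the RSZ reflex closure).  Under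
**`hdisj`** — the special images of distinct sheets are disjoint: `red (ℓ_e P) = θ(β)_s (red (ℓ_e Q)) ⇒ β = 1` (true for `v` unramified in `L`; A-p03's
organ INT-RES-SHEETS ∕ the `ModuliDatum` sheet field pay it) — every special point `x` has a well-defined DECK COORDINATE `β_x` (`x = θ(β_x)_s (red (ℓ_e P))`
by ★ SHEET-COVER, `β_x` unique by `hdisj`), and the **SHEET-WISE shadow `Fr₀ x := θ(β_x γ_e β_x⁻¹)_s (F̃ x)`** satisfies: (i) `FrobeniusSheet` — `Fr₀ x =
θ(γ_x)_s (F̃ x)` with `γ_x ∈ Γ`; (ii) the reading on EVERY sheet — `Fr₀ (red (ℓ_{e′} P)) = red (ℓ_{e′} (σ • P))` for all `e′`; (iii) `θ`-EQUIVARIANCE —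
`Fr₀ ∘ θ(γ)_s = θ(γ)_s ∘ Fr₀` (what transports the heart's (c3a)(c3b)(c3c) off the sheet-`e` image through SHEET-COVER).  [SerreTate1968] §1 Lemma 2,
[Shimura1998] §16.3 (1) (reduction of conjugates), [GortzWedhorn2020] (14.20) (Galois action on `X ×_K L`), [SGA1] V §1.

MAIN STATEMENTS.  §1 plumbing: `map_specialFibre_aut_mul` (`θ(a)_s ∘ θ(b)_s = θ(ab)_s`), `map_specialFibre_aut_one`, `map_frobeniusOver_map_specialFibre_aut`
(`F̃ ∘ θ(a)_s = θ(a)_s ∘ F̃`), `geomReductionMap_thickeningLift_comp_symm` (`red (ℓ_{e∘β⁻¹} P) = θ(β)_s (red (ℓ_e P))`), `map_specialFibre_aut_frobenius_geomReductionMap_thickeningLift`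
(`θ(γ_e)_s (F̃ (red (ℓ_e P))) = red (ℓ_e (σ • P))`); §2 `deck_eq_of_hdisj`; §3 **`exists_sheetwise_frobeniusShadow`** (heads (i)(ii)(iii)) and the `∃ σ`
package `exists_isAbsArithFrob_forall_sheetwise_frobeniusShadow`; §4 `hdisj_of_sheetMap` (the `ModuliDatum` sheet field implies `hdisj`).

## References
* [SerreTate1968] J.-P. Serre, J. Tate, *Good reduction of abelian varieties*, Ann. of Math. 88 (1968), §1 Lemma 2.
* [Shimura1998] G. Shimura, *Abelian Varieties with Complex Multiplication and Modular Functions* (1998), §16.3 (1).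
* [GortzWedhorn2020] U. Görtz, T. Wedhorn, *Algebraic Geometry I* (2nd ed., 2020), (14.20), §(4.8)–(4.9).
* [SGA1] A. Grothendieck, *SGA 1*, Exp. V §1 (schemes with a finite group of operators).
-/

set_option autoImplicit false

noncomputable section

open CategoryTheory _root_.AlgebraicGeometry Limits IsDedekindDomain IsDedekindDomain.HeightOneSpectrum Field
open scoped NumberField
open Literature.NumberTheory.EllipticCurves (genericFibre)
open Literature.NumberTheory.GaloisRepresentations (IsAbsArithFrob exists_isAbsArithFrob_holds)
open Literature.NumberTheory.DiophantineGeometry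
open Literature.AlgebraicGeometry.RelativeSpec (ActionOver)

universe u

namespace Literature.AlgebraicGeometry.Motives

namespace IntegralModel

variable {K : Type} [Field K] [NumberField K] {v : HeightOneSpectrum (𝓞 K)}

/-! ## §1 Plumbing: the action of `θ` and of Frobenius on the special points -/

section Plumbing

variable {Y : SchemeOver K} (𝓨 : IntegralModel (valuationSubringAtPrime K v) K Y) {H : Type*} [Group H] (θ : ActionOver 𝓨.total.hom H)

/-- `θ(b)` then `θ(a)` on the total space is `θ(a b)` (Mathlib's `Aut`: `f * g = g ≫ f`), in the `Over.isoMk` shape of the letters.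
[cite: SGA1, Exp. V §1] -/
theorem isoMk_aut_hom_comp (a b : H) :
    (Over.isoMk (θ.aut b) (θ.aut_comp b)).hom ≫ (Over.isoMk (θ.aut a) (θ.aut_comp a)).hom =
      (Over.isoMk (θ.aut (a * b)) (θ.aut_comp (a * b))).hom := by
  apply Over.OverMorphism.ext
  change (θ.aut b).hom ≫ (θ.aut a).hom = (θ.aut (a * b)).hom
  rw [map_mul, Aut.Aut_mul_def, Iso.trans_hom]

/-- **`θ(a)_s (θ(b)_s p) = θ(a b)_s p`** on the `κ̄(v)`-points of the special fibre (functoriality of ★ `specialFibreFunctor`).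
[cite: SGA1, Exp. V §1] -/
theorem map_specialFibre_aut_mul (a b : H) (p : AlgPoints 𝓨.reductionAt (geomResidueField v)) :
    AlgPoints.map ((specialFibreFunctor v).map (Over.isoMk (θ.aut a) (θ.aut_comp a)).hom : 𝓨.reductionAt ⟶ 𝓨.reductionAt)
        (AlgPoints.map ((specialFibreFunctor v).map (Over.isoMk (θ.aut b) (θ.aut_comp b)).hom : 𝓨.reductionAt ⟶ 𝓨.reductionAt) p) =
      AlgPoints.map ((specialFibreFunctor v).map (Over.isoMk (θ.aut (a * b)) (θ.aut_comp (a * b))).hom : 𝓨.reductionAt ⟶ 𝓨.reductionAt)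
        p := by
  rw [← AlgPoints.map_comp_apply, ← Functor.map_comp, isoMk_aut_hom_comp]

/-- **`θ(1)_s p = p`.** [cite: SGA1, Exp. V §1] -/
theorem map_specialFibre_aut_one (p : AlgPoints 𝓨.reductionAt (geomResidueField v)) :
    AlgPoints.map ((specialFibreFunctor v).map (Over.isoMk (θ.aut 1) (θ.aut_comp 1)).hom : 𝓨.reductionAt ⟶ 𝓨.reductionAt) p = p := by
  have h1 : (Over.isoMk (θ.aut (1 : H)) (θ.aut_comp 1)).hom = 𝟙 𝓨.total := by
    apply Over.OverMorphism.ext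
    change (θ.aut 1).hom = 𝟙 _
    rw [map_one]
    rfl
  rw [AlgPoints.map_apply, h1, (specialFibreFunctor v).map_id]
  exact Category.comp_id p

/-- **Frobenius commutes with `θ(a)_s`**: `F̃ (θ(a)_s p) = θ(a)_s (F̃ p)` (both are `κ(v)`-morphisms of the special fibre; ★
`AlgPoints.map_frobeniusOver_map`). [cite: SerreTate1968, §1 Lemma 2] -/
theorem map_frobeniusOver_map_specialFibre_aut (a : H) (p : AlgPoints 𝓨.reductionAt (geomResidueField v)) :
    AlgPoints.map (frobeniusOver 𝓨.reductionAt)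
        (AlgPoints.map ((specialFibreFunctor v).map (Over.isoMk (θ.aut a) (θ.aut_comp a)).hom : 𝓨.reductionAt ⟶ 𝓨.reductionAt) p) =
      AlgPoints.map ((specialFibreFunctor v).map (Over.isoMk (θ.aut a) (θ.aut_comp a)).hom : 𝓨.reductionAt ⟶ 𝓨.reductionAt)
        (AlgPoints.map (frobeniusOver 𝓨.reductionAt) p) := by
  simp only [AlgPoints.map_apply, Category.assoc]
  exact congrArg (p ≫ ·) (frobeniusOver_comp
    ((specialFibreFunctor v).map (Over.isoMk (θ.aut a) (θ.aut_comp a)).hom : 𝓨.reductionAt ⟶ 𝓨.reductionAt)).symm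

end Plumbing

section Thickening

variable {L : Type} [Field L] [Algebra K L]

/-- **`red (ℓ_{e ∘ β⁻¹} P) = θ(β)_s (red (ℓ_e P))`** — the reduction of the section on the sheet `e ∘ β⁻¹` is the `θ(β, 1)_s`-translate of the reduction
of the section on the sheet `e` (★ `map_aut_thickeningLift` + ★ `geomReductionMap_map_thickeningGalAction_of_hθ`). [cite: GortzWedhorn2020, (14.20)]
[cite: SerreTate1968, §1 Lemma 2] -/
theorem geomReductionMap_thickeningLift_comp_symm (X : SchemeOver K) {G : Type*} [Group G]
    (𝓨 : IntegralModel (valuationSubringAtPrime K v) K ((thickening K L).obj X)) [IsProper 𝓨.total.hom]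
    (θ : ActionOver 𝓨.total.hom ((L ≃ₐ[K] L) × G))
    (hθ : ∀ γ : L ≃ₐ[K] L,
      (genericFibre (valuationSubringAtPrime K v) K).map (Over.isoMk (θ.aut (γ, 1)) (θ.aut_comp (γ, 1))).hom ≫ 𝓨.genericIso'.hom =
        𝓨.genericIso'.hom ≫
          (Over.isoMk ((thickeningGalAction (L := L) X).aut γ) ((thickeningGalAction (L := L) X).aut_comp γ)).hom)
    (e : L →ₐ[K] AlgebraicClosure (v.adicCompletion K)) (β : L ≃ₐ[K] L) (P : AlgPoints X (AlgebraicClosure (v.adicCompletion K))) :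
    𝓨.geomReductionMap (thickeningLift (e.comp (β.symm : L →ₐ[K] L)) X P) =
      AlgPoints.map ((specialFibreFunctor v).map (Over.isoMk (θ.aut (β, 1)) (θ.aut_comp (β, 1))).hom : 𝓨.reductionAt ⟶ 𝓨.reductionAt)
        (𝓨.geomReductionMap (thickeningLift e X P)) := by
  rw [← map_aut_thickeningLift, 𝓨.geomReductionMap_map_thickeningGalAction_of_hθ X θ hθ β]

/-- **The uniform reading, solved for the reduction of the conjugate**: if `σ ∘ e = e ∘ γ_e` then
`θ(γ_e)_s (F̃ (red (ℓ_e P))) = red (ℓ_e (σ • P))` (★ B-p18 `map_frobeniusOver_geomReductionMap_thickeningLift` with `𝔲 = θ(γ_e⁻¹, 1)`, then `θ(γ_e)_s`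
applied). [cite: SerreTate1968, §1 Lemma 2] [cite: Shimura1998, §16.3 (1)] [cite: GortzWedhorn2020, (14.20)] -/
theorem map_specialFibre_aut_frobenius_geomReductionMap_thickeningLift (X : SchemeOver K) {G : Type*} [Group G]
    (𝓨 : IntegralModel (valuationSubringAtPrime K v) K ((thickening K L).obj X)) [IsProper 𝓨.total.hom]
    (θ : ActionOver 𝓨.total.hom ((L ≃ₐ[K] L) × G))
    (hθ : ∀ γ : L ≃ₐ[K] L,
      (genericFibre (valuationSubringAtPrime K v) K).map (Over.isoMk (θ.aut (γ, 1)) (θ.aut_comp (γ, 1))).hom ≫ 𝓨.genericIso'.hom =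
        𝓨.genericIso'.hom ≫
          (Over.isoMk ((thickeningGalAction (L := L) X).aut γ) ((thickeningGalAction (L := L) X).aut_comp γ)).hom)
    {σ : absoluteGaloisGroup (v.adicCompletion K)} (hσ : IsAbsArithFrob σ)
    (e : L →ₐ[K] AlgebraicClosure (v.adicCompletion K)) (γ : L ≃ₐ[K] L)
    (hγ : ((AlgEquiv.restrictScalars K (absoluteGaloisGroup.toAlgEquiv (v.adicCompletion K) σ) :
        AlgebraicClosure (v.adicCompletion K) ≃ₐ[K] AlgebraicClosure (v.adicCompletion K)) :
        AlgebraicClosure (v.adicCompletion K) →ₐ[K] AlgebraicClosure (v.adicCompletion K)).comp e = e.comp (γ : L →ₐ[K] L))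
    (P : AlgPoints X (AlgebraicClosure (v.adicCompletion K))) :
    AlgPoints.map ((specialFibreFunctor v).map (Over.isoMk (θ.aut (γ, 1)) (θ.aut_comp (γ, 1))).hom : 𝓨.reductionAt ⟶ 𝓨.reductionAt)
        (AlgPoints.map (frobeniusOver 𝓨.reductionAt) (𝓨.geomReductionMap (thickeningLift e X P))) =
      𝓨.geomReductionMap (thickeningLift e X (σ • P)) := by
  have h𝔲 : (genericFibre (valuationSubringAtPrime K v) K).map (Over.isoMk (θ.aut (γ.symm, 1)) (θ.aut_comp (γ.symm, 1))).hom ≫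
      𝓨.genericIso'.hom =
        𝓨.genericIso'.hom ≫ Over.homMk ((thickeningGalAction X).aut γ.symm).hom ((thickeningGalAction X).aut_comp γ.symm) := by
    rw [hθ γ.symm, isoMk_thickeningGalAction_aut_hom]
  have h := 𝓨.map_frobeniusOver_geomReductionMap_thickeningLift X hσ e γ hγ _ h𝔲 P
  exact (congrArg (AlgPoints.map
      ((specialFibreFunctor v).map (Over.isoMk (θ.aut (γ, 1)) (θ.aut_comp (γ, 1))).hom : 𝓨.reductionAt ⟶ 𝓨.reductionAt)) h).trans
    (𝓨.map_specialFibre_aut_map_specialFibre_aut θ (γ, 1) (γ.symm, 1) (Prod.ext (mul_inv_cancel γ) (mul_one 1)) _)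

/-! ## §2 Under `hdisj` the deck coordinate of a special point is unique -/

/-- **Deck uniqueness under disjoint special sheets**: if `θ(β)_s (red (ℓ_e P)) = θ(β′)_s (red (ℓ_e P′))` then `β = β′` (translate by `θ(β⁻¹)_s`
and apply `hdisj`). [cite: SGA1, Exp. V §1] -/
theorem deck_eq_of_hdisj (X : SchemeOver K) {G : Type*} [Group G]
    (𝓨 : IntegralModel (valuationSubringAtPrime K v) K ((thickening K L).obj X)) [IsProper 𝓨.total.hom]
    (θ : ActionOver 𝓨.total.hom ((L ≃ₐ[K] L) × G)) (e : L →ₐ[K] AlgebraicClosure (v.adicCompletion K))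
    (hdisj : ∀ (β : L ≃ₐ[K] L) (P Q : AlgPoints X (AlgebraicClosure (v.adicCompletion K))),
      𝓨.geomReductionMap (thickeningLift e X P) =
        AlgPoints.map ((specialFibreFunctor v).map (Over.isoMk (θ.aut (β, 1)) (θ.aut_comp (β, 1))).hom : 𝓨.reductionAt ⟶ 𝓨.reductionAt)
          (𝓨.geomReductionMap (thickeningLift e X Q)) → β = 1)
    {β β' : L ≃ₐ[K] L} {P P' : AlgPoints X (AlgebraicClosure (v.adicCompletion K))}
    (h : AlgPoints.map ((specialFibreFunctor v).map (Over.isoMk (θ.aut (β, 1)) (θ.aut_comp (β, 1))).hom : 𝓨.reductionAt ⟶ 𝓨.reductionAt)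
        (𝓨.geomReductionMap (thickeningLift e X P)) =
      AlgPoints.map ((specialFibreFunctor v).map (Over.isoMk (θ.aut (β', 1)) (θ.aut_comp (β', 1))).hom : 𝓨.reductionAt ⟶ 𝓨.reductionAt)
        (𝓨.geomReductionMap (thickeningLift e X P'))) :
    β = β' := by
  have h' := congrArg
    (AlgPoints.map ((specialFibreFunctor v).map (Over.isoMk (θ.aut (β⁻¹, 1)) (θ.aut_comp (β⁻¹, 1))).hom : 𝓨.reductionAt ⟶ 𝓨.reductionAt)) h
  rw [𝓨.map_specialFibre_aut_mul θ, 𝓨.map_specialFibre_aut_mul θ, Prod.mk_mul_mk, Prod.mk_mul_mk, inv_mul_cancel, mul_one,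
    show ((1 : L ≃ₐ[K] L), (1 : G)) = 1 from rfl, 𝓨.map_specialFibre_aut_one θ] at h'
  have h1 : β⁻¹ * β' = 1 := hdisj (β⁻¹ * β') P P' h'
  rw [inv_mul_eq_one] at h1
  exact h1

/-! ## §3 The sheet-wise, `θ`-equivariant shadow of Frobenius -/

/-- **THE SHEET-WISE SHADOW OF FROBENIUS** (P6c «SHEETS-2» heads (i)(ii)(iii); ref1 n25 (J4)).  `L ∕ K` normal, `𝓨` a proper flat model of `R_L X`
with `θ` as in MH, `σ` an arithmetic Frobenius, `e` a sheet, and `hdisj` (disjoint special sheets).  Then there is `Fr₀ : 𝓨_v(κ̄) → 𝓨_v(κ̄)` with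
(i) `∀ p, ∃ γ, Fr₀ p = θ(γ)_s (F̃ p)` (the body of MH's `FrobeniusSheet`), (ii) `Fr₀ (red (ℓ_{e′} P)) = red (ℓ_{e′} (σ • P))` for EVERY sheet `e′` and
every `P`, (iii) `Fr₀ (θ(γ)_s p) = θ(γ)_s (Fr₀ p)` for every `γ`.  Construction: `Fr₀ x := θ(β_x γ_e β_x⁻¹)_s (F̃ x)` with `β_x` the deck coordinate
of `x` relative to the sheet `e` (★ SHEET-COVER, unique by `hdisj`) and `σ ∘ e = e ∘ γ_e` (★ `exists_algEquiv_comp_eq_comp`).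
[cite: SerreTate1968, §1 Lemma 2] [cite: Shimura1998, §16.3 (1)] [cite: GortzWedhorn2020, (14.20)] [cite: SGA1, Exp. V §1] -/
theorem exists_sheetwise_frobeniusShadow [Normal K L] (X : SchemeOver K) {G : Type*} [Group G]
    (𝓨 : IntegralModel (valuationSubringAtPrime K v) K ((thickening K L).obj X)) [IsProper 𝓨.total.hom] [Flat 𝓨.total.hom]
    (θ : ActionOver 𝓨.total.hom ((L ≃ₐ[K] L) × G))
    (hθ : ∀ γ : L ≃ₐ[K] L,
      (genericFibre (valuationSubringAtPrime K v) K).map (Over.isoMk (θ.aut (γ, 1)) (θ.aut_comp (γ, 1))).hom ≫ 𝓨.genericIso'.hom =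
        𝓨.genericIso'.hom ≫
          (Over.isoMk ((thickeningGalAction (L := L) X).aut γ) ((thickeningGalAction (L := L) X).aut_comp γ)).hom)
    {σ : absoluteGaloisGroup (v.adicCompletion K)} (hσ : IsAbsArithFrob σ) (e : L →ₐ[K] AlgebraicClosure (v.adicCompletion K))
    (hdisj : ∀ (β : L ≃ₐ[K] L) (P Q : AlgPoints X (AlgebraicClosure (v.adicCompletion K))),
      𝓨.geomReductionMap (thickeningLift e X P) =
        AlgPoints.map ((specialFibreFunctor v).map (Over.isoMk (θ.aut (β, 1)) (θ.aut_comp (β, 1))).hom : 𝓨.reductionAt ⟶ 𝓨.reductionAt)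
          (𝓨.geomReductionMap (thickeningLift e X Q)) → β = 1) :
    ∃ Fr₀ : AlgPoints 𝓨.reductionAt (geomResidueField v) → AlgPoints 𝓨.reductionAt (geomResidueField v),
      (∀ p : AlgPoints 𝓨.reductionAt (geomResidueField v), ∃ γ : L ≃ₐ[K] L,
        Fr₀ p = AlgPoints.map
            ((specialFibreFunctor v).map (Over.isoMk (θ.aut (γ, 1)) (θ.aut_comp (γ, 1))).hom : 𝓨.reductionAt ⟶ 𝓨.reductionAt)
          (AlgPoints.map (frobeniusOver 𝓨.reductionAt) p)) ∧
      (∀ (e' : L →ₐ[K] AlgebraicClosure (v.adicCompletion K)) (P : AlgPoints X (AlgebraicClosure (v.adicCompletion K))),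
        Fr₀ (𝓨.geomReductionMap (thickeningLift e' X P)) = 𝓨.geomReductionMap (thickeningLift e' X (σ • P))) ∧
      (∀ (γ : L ≃ₐ[K] L) (p : AlgPoints 𝓨.reductionAt (geomResidueField v)),
        Fr₀ (AlgPoints.map
            ((specialFibreFunctor v).map (Over.isoMk (θ.aut (γ, 1)) (θ.aut_comp (γ, 1))).hom : 𝓨.reductionAt ⟶ 𝓨.reductionAt) p) =
          AlgPoints.map
              ((specialFibreFunctor v).map (Over.isoMk (θ.aut (γ, 1)) (θ.aut_comp (γ, 1))).hom : 𝓨.reductionAt ⟶ 𝓨.reductionAt)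
            (Fr₀ p)) := by
  classical
  -- notation: the action of `θ(γ, 1)` on special points, Frobenius, and the Frobenius element `δ` of the sheet `e`
  let ts : (L ≃ₐ[K] L) → AlgPoints 𝓨.reductionAt (geomResidueField v) → AlgPoints 𝓨.reductionAt (geomResidueField v) :=
    fun γ p => AlgPoints.map
      ((specialFibreFunctor v).map (Over.isoMk (θ.aut (γ, 1)) (θ.aut_comp (γ, 1))).hom : 𝓨.reductionAt ⟶ 𝓨.reductionAt) p
  have ts_def : ∀ γ p, ts γ p = AlgPoints.map
      ((specialFibreFunctor v).map (Over.isoMk (θ.aut (γ, 1)) (θ.aut_comp (γ, 1))).hom : 𝓨.reductionAt ⟶ 𝓨.reductionAt) p :=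
    fun _ _ => rfl
  have ts_mul : ∀ a b p, ts a (ts b p) = ts (a * b) p := fun a b p => by
    rw [ts_def, ts_def, ts_def, 𝓨.map_specialFibre_aut_mul θ, Prod.mk_mul_mk, mul_one]
  have ts_one : ∀ p, ts 1 p = p := fun p => by
    rw [ts_def, show ((1 : L ≃ₐ[K] L), (1 : G)) = 1 from rfl, 𝓨.map_specialFibre_aut_one θ]
  have ts_frob : ∀ a p, AlgPoints.map (frobeniusOver 𝓨.reductionAt) (ts a p) = ts a (AlgPoints.map (frobeniusOver 𝓨.reductionAt) p) :=
    fun a p => 𝓨.map_frobeniusOver_map_specialFibre_aut θ (a, 1) p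
  obtain ⟨δ, hδ⟩ := exists_algEquiv_comp_eq_comp
    (AlgEquiv.restrictScalars K (absoluteGaloisGroup.toAlgEquiv (v.adicCompletion K) σ)) e
  -- the deck coordinate `βof x` of a special point `x`, relative to the sheet `e` (SHEET-COVER; unique by `hdisj`)
  have hcov := fun x => 𝓨.exists_aut_geomReductionMap_thickeningLift_eq X θ hθ e x
  let βof : AlgPoints 𝓨.reductionAt (geomResidueField v) → (L ≃ₐ[K] L) := fun x => Classical.choose (hcov x)
  have hβof : ∀ x, ∃ P, x = ts (βof x) (𝓨.geomReductionMap (thickeningLift e X P)) := fun x =>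
    Classical.choose_spec (hcov x)
  have hβ_eq : ∀ x (β : L ≃ₐ[K] L) (P : AlgPoints X (AlgebraicClosure (v.adicCompletion K))),
      x = ts β (𝓨.geomReductionMap (thickeningLift e X P)) → βof x = β := by
    intro x β P hx
    obtain ⟨P', hP'⟩ := hβof x
    exact (𝓨.deck_eq_of_hdisj X θ e hdisj (hx.symm.trans hP')).symm
  -- the sheet-wise shadow
  refine ⟨fun x => ts (βof x * δ * (βof x)⁻¹) (AlgPoints.map (frobeniusOver 𝓨.reductionAt) x), fun p => ⟨_, rfl⟩,
    fun e' P => ?_, fun γ p => ?_⟩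
  · -- (ii) the reading on the sheet `e′ = e ∘ β⁻¹`
    obtain ⟨τ, hτ⟩ := exists_algEquiv_comp_eq_of_normal e e'
    have he' : e' = e.comp ((τ.symm).symm : L →ₐ[K] L) := by rw [AlgEquiv.symm_symm, hτ]
    have hx : 𝓨.geomReductionMap (thickeningLift e' X P) = ts τ.symm (𝓨.geomReductionMap (thickeningLift e X P)) := by
      rw [he', ts_def]
      exact 𝓨.geomReductionMap_thickeningLift_comp_symm X θ hθ e τ.symm P
    have hβx := hβ_eq _ _ _ hx
    change ts (βof (𝓨.geomReductionMap (thickeningLift e' X P)) * δ * (βof (𝓨.geomReductionMap (thickeningLift e' X P)))⁻¹)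
      (AlgPoints.map (frobeniusOver 𝓨.reductionAt) (𝓨.geomReductionMap (thickeningLift e' X P))) = _
    rw [hβx, hx, ts_frob, ts_mul, show τ.symm * δ * (τ.symm)⁻¹ * τ.symm = τ.symm * δ by group, ← ts_mul]
    have hδP := 𝓨.map_specialFibre_aut_frobenius_geomReductionMap_thickeningLift X θ hθ hσ e δ hδ P
    refine (congrArg (ts τ.symm) hδP).trans ?_
    rw [he']
    exact (𝓨.geomReductionMap_thickeningLift_comp_symm X θ hθ e τ.symm (σ • P)).symm
  · -- (iii) `θ`-equivariance
    obtain ⟨P, hP⟩ := hβof p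
    have hy : ts γ p = ts (γ * βof p) (𝓨.geomReductionMap (thickeningLift e X P)) := by
      rw [← ts_mul, ← hP]
    have hβy := hβ_eq _ _ _ hy
    change ts (βof (ts γ p) * δ * (βof (ts γ p))⁻¹) (AlgPoints.map (frobeniusOver 𝓨.reductionAt) (ts γ p)) =
      ts γ (ts (βof p * δ * (βof p)⁻¹) (AlgPoints.map (frobeniusOver 𝓨.reductionAt) p))
    rw [hβy, ts_frob, ts_mul, ts_mul, show γ * βof p * δ * (γ * βof p)⁻¹ * γ = γ * (βof p * δ * (βof p)⁻¹) by group]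

/-- **The `∃ σ` package** (shape of ★ `exists_isAbsArithFrob_forall_frobeniusSheet_reading`): one arithmetic Frobenius `σ ∈ Γ_{K_v}` such that for every
normal `L ∕ K`, `X`, proper flat model `𝓨` of `R_L X` with `θ` as in MH, sheet `e` and `hdisj`, the sheet-wise `θ`-equivariant shadow exists with
(i)(ii)(iii). [cite: SerreTate1968, §1 Lemma 2] [cite: Shimura1998, §16.3 (1)] -/
theorem exists_isAbsArithFrob_forall_sheetwise_frobeniusShadow :
    ∃ σ : absoluteGaloisGroup (v.adicCompletion K), IsAbsArithFrob σ ∧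
      ∀ (L : Type) [Field L] [Algebra K L] [Normal K L] (X : SchemeOver K) (G : Type) [Group G]
        (𝓨 : IntegralModel (valuationSubringAtPrime K v) K ((thickening K L).obj X)) [IsProper 𝓨.total.hom] [Flat 𝓨.total.hom]
        (θ : ActionOver 𝓨.total.hom ((L ≃ₐ[K] L) × G)),
        (∀ γ : L ≃ₐ[K] L,
          (genericFibre (valuationSubringAtPrime K v) K).map (Over.isoMk (θ.aut (γ, 1)) (θ.aut_comp (γ, 1))).hom ≫ 𝓨.genericIso'.hom =
            𝓨.genericIso'.hom ≫
              (Over.isoMk ((thickeningGalAction (L := L) X).aut γ) ((thickeningGalAction (L := L) X).aut_comp γ)).hom) →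
        ∀ e : L →ₐ[K] AlgebraicClosure (v.adicCompletion K),
          (∀ (β : L ≃ₐ[K] L) (P Q : AlgPoints X (AlgebraicClosure (v.adicCompletion K))),
            𝓨.geomReductionMap (thickeningLift e X P) =
              AlgPoints.map
                  ((specialFibreFunctor v).map (Over.isoMk (θ.aut (β, 1)) (θ.aut_comp (β, 1))).hom : 𝓨.reductionAt ⟶ 𝓨.reductionAt)
                (𝓨.geomReductionMap (thickeningLift e X Q)) → β = 1) →
          ∃ Fr₀ : AlgPoints 𝓨.reductionAt (geomResidueField v) → AlgPoints 𝓨.reductionAt (geomResidueField v),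
            (∀ p : AlgPoints 𝓨.reductionAt (geomResidueField v), ∃ γ : L ≃ₐ[K] L,
              Fr₀ p = AlgPoints.map
                  ((specialFibreFunctor v).map (Over.isoMk (θ.aut (γ, 1)) (θ.aut_comp (γ, 1))).hom : 𝓨.reductionAt ⟶ 𝓨.reductionAt)
                (AlgPoints.map (frobeniusOver 𝓨.reductionAt) p)) ∧
            (∀ (e' : L →ₐ[K] AlgebraicClosure (v.adicCompletion K)) (P : AlgPoints X (AlgebraicClosure (v.adicCompletion K))),
              Fr₀ (𝓨.geomReductionMap (thickeningLift e' X P)) = 𝓨.geomReductionMap (thickeningLift e' X (σ • P))) ∧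
            (∀ (γ : L ≃ₐ[K] L) (p : AlgPoints 𝓨.reductionAt (geomResidueField v)),
              Fr₀ (AlgPoints.map
                  ((specialFibreFunctor v).map (Over.isoMk (θ.aut (γ, 1)) (θ.aut_comp (γ, 1))).hom : 𝓨.reductionAt ⟶ 𝓨.reductionAt) p) =
                AlgPoints.map
                    ((specialFibreFunctor v).map (Over.isoMk (θ.aut (γ, 1)) (θ.aut_comp (γ, 1))).hom : 𝓨.reductionAt ⟶ 𝓨.reductionAt)
                  (Fr₀ p)) := by
  obtain ⟨σ, hσ⟩ : ∃ σ : absoluteGaloisGroup (v.adicCompletion K), IsAbsArithFrob σ := exists_isAbsArithFrob_holds _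
  exact ⟨σ, hσ, fun L _ _ _ X G _ 𝓨 _ _ θ hθ e hdisj => 𝓨.exists_sheetwise_frobeniusShadow X θ hθ hσ e hdisj⟩

/-! ## §4 `hdisj` from a sheet map (the `ModuliDatum` sheet field) -/

/-- **A sheet map forces disjoint special sheets.**  If some map `sh` from the special points to ANY type `T` with a map `act : Aut(L∕K) → T → T`
is CONSTANT `= c` on the reductions of the sheet-`e` sections, intertwines `θ(γ)_s` with `act γ`, and `c` has trivial stabiliser, then `hdisj` holds —
the shape in which the `ModuliDatum` sheet field `sh : P₀ → (𝓞 Fᵢ →ₐ[𝓞 F] κ̄(w))` (LEAD M-12c (α)) or ★ INT-RES-SHEETS (A-p03, (β)) pay `hdisj` for `v`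
unramified in `L`. [cite: SGA1, Exp. V §1] -/
theorem hdisj_of_sheetMap (X : SchemeOver K) {G : Type*} [Group G]
    (𝓨 : IntegralModel (valuationSubringAtPrime K v) K ((thickening K L).obj X)) [IsProper 𝓨.total.hom]
    (θ : ActionOver 𝓨.total.hom ((L ≃ₐ[K] L) × G)) (e : L →ₐ[K] AlgebraicClosure (v.adicCompletion K))
    {T : Type*} (sh : AlgPoints 𝓨.reductionAt (geomResidueField v) → T) (act : (L ≃ₐ[K] L) → T → T) (c : T)
    (hshe : ∀ P : AlgPoints X (AlgebraicClosure (v.adicCompletion K)), sh (𝓨.geomReductionMap (thickeningLift e X P)) = c)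
    (hshθ : ∀ (γ : L ≃ₐ[K] L) (x : AlgPoints 𝓨.reductionAt (geomResidueField v)),
      sh (AlgPoints.map
          ((specialFibreFunctor v).map (Over.isoMk (θ.aut (γ, 1)) (θ.aut_comp (γ, 1))).hom : 𝓨.reductionAt ⟶ 𝓨.reductionAt) x) =
        act γ (sh x))
    (hfree : ∀ γ : L ≃ₐ[K] L, act γ c = c → γ = 1)
    (β : L ≃ₐ[K] L) (P Q : AlgPoints X (AlgebraicClosure (v.adicCompletion K)))
    (h : 𝓨.geomReductionMap (thickeningLift e X P) =
      AlgPoints.map ((specialFibreFunctor v).map (Over.isoMk (θ.aut (β, 1)) (θ.aut_comp (β, 1))).hom : 𝓨.reductionAt ⟶ 𝓨.reductionAt)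
        (𝓨.geomReductionMap (thickeningLift e X Q))) :
    β = 1 := by
  have h1 : c = act β c :=
    calc c = sh (𝓨.geomReductionMap (thickeningLift e X P)) := (hshe P).symm
      _ = sh (AlgPoints.map
            ((specialFibreFunctor v).map (Over.isoMk (θ.aut (β, 1)) (θ.aut_comp (β, 1))).hom : 𝓨.reductionAt ⟶ 𝓨.reductionAt)
            (𝓨.geomReductionMap (thickeningLift e X Q))) := congrArg sh h
      _ = act β (sh (𝓨.geomReductionMap (thickeningLift e X Q))) := hshθ β _
      _ = act β c := by rw [hshe]
  exact hfree β h1.symm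

end Thickening

end IntegralModel

end Literature.AlgebraicGeometry.Motives

end
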